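import Summits.QuantumFields.BalabanUV.Beta.GAN24.TorusAvatarBridge
import Literature.MathematicalPhysics.QuantumFieldTheory.Balaban1983to89.Beta.ResolventComposition

/-!
# `BalabanUV.Beta.GAN24.TorusPeriodise` — binder row G-an2-4 / (CONV-C), S6 dictionary (mm channel), leaf P1-L13b part 1 (S6mm-2a):
# the PERIODISED minimiser columns `ℋ^per = Σ_{t∈ℤ^D} ℋ_N(·; (l, q − pshift M t))` of an2's typed blocking-`N` system and their
# multipliers `Φ^per` — summability over the period lattice, the gauge-free Euler–Lagrange identity `d*d ℋ^per = 𝒬ᵀ Φ^per` and the block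
# averages `𝒬 ℋ^per = [κ = l ∧ y ≡ q mod M]` SURVIVE periodisation, and `ℋ^per` / `Φ^per` are `(N·M)`- / `M`-periodic

NOT IN PRINT; OUR BOOKKEEPING.  HONEST FRAMING (cell contract, verbatim): «discharging `BetaPertH` makes Bałaban's UV stability
UNCONDITIONAL — a real constructive-QFT result; it is NOT the continuum limit and NOT the Clay problem.»  HONEST DEPENDENCY (verbatim):
«continuum YM on T⁴ ⇐ BetaPertH ∧ nine spine estimates (0/9 proved); BetaPertH ⇐ (D1) ∧ (D4) ∧ CAP+tail; G-an2-4 gates asym, D1 and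
NE2/3/4.»  [folklore] absolutely convergent re-indexing over an5's `ResolventComposition` (`Hcol`, `HΦcol`, `curvAdj_curv_Hcol` = the
Euler–Lagrange identity WITHOUT gauge term, `wM_eq_zero`; `contourSum_Hcol`) and an2's `KernelSpecInstance` (`decay_wH`, `decay_wΦ`, the
`hasSum_*` transport of finite stencils); cites nothing, mints no fact, instantiates no binder.  NOT summit progress.

CONTENTS (0 sorry).  §1 `pshift P t = (P_ν t_ν)_ν` (`pshift_add/zero/unitVec/fine/injective`, `toTor_pshift`, `l1_le_l1_pshift`),
**`summable_pshift`** (an exponentially decaying lattice function is summable along every coset of the period lattice), `tsum_shift_index`.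
§2 `Hper N M l q`, `Φper N M l q` (defs with bodies), `Hcol_sub_pshift` / `HΦcol_sub_pshift` (the summands are period translates of `wH` / `wΦ`),
`summable_Hcol_pshift`, `summable_HΦcol_pshift`, `hasSum_Hper`, `hasSum_Φper`, **`curvAdj_curv_Hper`** ((EL)^per), **`contourSum_Hper`**
((Q)^per: `contourSum N (Hper N M l q) κ y = if κ = l ∧ toTor M y = toTor M q then 1 else 0`), `periodic_Hper` (fine period `fine N M`),
`periodic_Φper` (coarse period `M`), `Φper_congr` (`Φ^per_{(l,q)} κ y` depends on `y − q` mod `M` only).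
NEXT: `GAN24/TorusJunction` (the Gram identity against b05's `H_k`).  Unit b2b-balaban-gan24-formalise-leaf-18 (gen 5), 2026-08-19.
NOT the K-slot, NOT `BetaPertH`, NOT continuum, NOT Clay.
-/

open Finset
open scoped BigOperators ComplexConjugate Matrix

namespace Summit.QuantumFields.BalabanUV.Beta.GAN24.TorusPeriodise

open Literature.MathematicalPhysics.QuantumFieldTheory
open Literature.MathematicalPhysics.QuantumFieldTheory.Balaban1983to89
open Literature.MathematicalPhysics.QuantumFieldTheory.Balaban1983to89.Beta
open AffineAveraging (Site Form0 Form1 Form2 dz curv curvAdj box toSite contourSum)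
open AffineReproduction (contourSumAdj)
open B12Sec2to5 (l1 l1_nonneg Decay510 summable_exp_neg_l1)
open B5Prop11Plancherel (Tor fine)
open KernelSpecInstance (wH wΦ decay_wH decay_wΦ hasSum_curv hasSum_curvAdj hasSum_contourSum hasSum_contourSumAdj)
open ResolventComposition (Hcol HΦcol Hcol_apply HΦcol_apply curvAdj_curv_Hcol contourSum_Hcol)
open Summit.QuantumFields.BalabanUV.Beta.GAN24.TorusAvatar (toTor liftT Periodic av toTor_liftT toTor_add toTor_sub toTor_periods)

noncomputable section

variable {D : ℕ}

/-! ## §1 Period translations and summability over the period lattice -/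

/-- The period translation `t ↦ (P_ν t_ν)_ν` of the lattice `ℤ^D` by the torus sizes `P`. -/
def pshift (P : Fin D → ℕ) (t : Site D) : Site D := fun ν => ((P ν : ℕ) : ℤ) * t ν

/-- `pshift` is additive. -/
theorem pshift_add (P : Fin D → ℕ) (t s : Site D) : pshift P (t + s) = pshift P t + pshift P s := by
  funext ν; simp [pshift, mul_add]

/-- `pshift 0 = 0`. -/
theorem pshift_zero (P : Fin D → ℕ) : pshift P 0 = 0 := by funext ν; simp [pshift]

/-- `pshift` of a unit vector is `P_ν e_ν`. -/
theorem pshift_unitVec (P : Fin D → ℕ) (ν : Fin D) :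
    pshift P (AffineAveraging.unitVec ν) = ((P ν : ℕ) : ℤ) • AffineAveraging.unitVec ν := by
  funext i
  by_cases h : i = ν
  · subst h; simp [pshift, AffineAveraging.unitVec]
  · simp [pshift, AffineAveraging.unitVec, h]

/-- Period translations reduce to `0` on the torus. -/
theorem toTor_pshift (P : Fin D → ℕ) (t : Site D) : toTor P (pshift P t) = 0 := toTor_periods P t

/-- The fine period translation is `N •` the coarse one: `pshift (fine N M) t = N • pshift M t`. -/
theorem pshift_fine (N : ℕ) (M : Fin D → ℕ) (t : Site D) : pshift (fine N M) t = (N : ℤ) • pshift M t := by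
  funext ν; simp [pshift, fine, mul_assoc]

/-- `pshift` is injective when all periods are nonzero. -/
theorem pshift_injective (P : Fin D → ℕ) [∀ ν, NeZero (P ν)] : Function.Injective (pshift P) := by
  intro t s h
  funext ν
  have hν := congr_fun h ν
  simp only [pshift] at hν
  exact mul_left_cancel₀ (by exact_mod_cast NeZero.ne (P ν)) hν

/-- A period translate is at least as long as the index: `|t|₁ ≤ |pshift P t|₁` (`P_ν ≥ 1`). -/
theorem l1_le_l1_pshift (P : Fin D → ℕ) [∀ ν, NeZero (P ν)] (t : Site D) : l1 t ≤ l1 (pshift P t) := by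
  unfold l1
  refine Finset.sum_le_sum fun ν _ => ?_
  simp only [pshift, Int.cast_mul, Int.cast_natCast, abs_mul, Nat.abs_cast]
  have h1 : (1 : ℝ) ≤ (P ν : ℝ) := by exact_mod_cast Nat.one_le_iff_ne_zero.2 (NeZero.ne (P ν))
  nlinarith [abs_nonneg ((t ν : ℤ) : ℝ)]

/-- **SUMMABILITY OVER THE PERIOD LATTICE**: an exponentially decaying lattice function is summable along every coset `x + pshift P ℤ^D`. -/
theorem summable_pshift {f : Site D → ℝ} {C δ : ℝ} (hδ : 0 < δ) (hf : ∀ z, |f z| ≤ C * Real.exp (-δ * l1 z))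
    (P : Fin D → ℕ) [∀ ν, NeZero (P ν)] (x : Site D) : Summable (fun t : Site D => f (x + pshift P t)) := by
  refine Summable.of_norm_bounded (g := fun t : Site D => (C * Real.exp (δ * l1 x)) * Real.exp (-δ * l1 t))
    ((summable_exp_neg_l1 hδ D).mul_left _) fun t => ?_
  rw [Real.norm_eq_abs]
  refine (hf _).trans ?_
  have hC : 0 ≤ C := by
    have := hf x
    have hpos : 0 < Real.exp (-δ * l1 x) := Real.exp_pos _
    nlinarith [abs_nonneg (f x)]
  have htri : l1 (pshift P t) ≤ l1 (x + pshift P t) + l1 x := by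
    have h := ExpKernelCalculus.l1_sub_triangle (pshift P t) (-x) 0
    have hn : l1 (-x : Site D) = l1 x := by unfold l1; simp
    rw [sub_zero, sub_zero, sub_neg_eq_add, hn, add_comm (pshift P t) x] at h
    exact h
  have hle : -δ * l1 (x + pshift P t) ≤ δ * l1 x + (-δ * l1 t) := by
    have := l1_le_l1_pshift P t
    nlinarith
  calc C * Real.exp (-δ * l1 (x + pshift P t)) ≤ C * Real.exp (δ * l1 x + -δ * l1 t) :=
        mul_le_mul_of_nonneg_left (Real.exp_le_exp.2 hle) hC
    _ = C * Real.exp (δ * l1 x) * Real.exp (-δ * l1 t) := by rw [Real.exp_add]; ring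

/-- Re-indexing a period-lattice sum by a translation of the index. -/
theorem tsum_shift_index (g : Site D → ℝ) (v : Site D) : ∑' t : Site D, g (t + v) = ∑' t : Site D, g t :=
  (Equiv.addRight v).tsum_eq g

end

/-! ## §2 The periodised minimiser columns of an2's typed system -/

section Columns

variable {d : ℕ} (N : ℕ) [NeZero N] (M : Fin (d + 1) → ℕ) [∀ ν, NeZero (M ν)]

/-- **THE PERIODISED MINIMISER COLUMN** `ℋ^per_{(l,q)} := Σ_{t ∈ ℤ^D} ℋ_N(·; (l, q − pshift M t))` — the minimiser column of an2's
blocking-`N` system with source at the coarse bond `(l, q)`, summed over the coarse period lattice `pshift M ℤ^D`. -/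
noncomputable def Hper (l : Fin (d + 1)) (q : Site (d + 1)) : Form1 (d + 1) ℝ :=
  fun κ x => ∑' t : Site (d + 1), Hcol (N := N) l (q - pshift M t) κ x

/-- Its periodised constraint multiplier `Φ^per_{(l,q)} := Σ_t Φ^ℋ(·; (l, q − pshift M t))`, i.e. `κ, y ↦ Σ_t wΦ κ l (y − q + pshift M t)`. -/
noncomputable def Φper (l : Fin (d + 1)) (q : Site (d + 1)) : Form1 (d + 1) ℝ :=
  fun κ y => ∑' t : Site (d + 1), HΦcol (N := N) l (q - pshift M t) κ y

omit [∀ ν, NeZero (M ν)] in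
/-- The shifted column is the fine-period translate of `wH`. -/
theorem Hcol_sub_pshift (l : Fin (d + 1)) (q : Site (d + 1)) (t : Site (d + 1)) (κ : Fin (d + 1)) (x : Site (d + 1)) :
    Hcol (N := N) l (q - pshift M t) κ x = wH (N := N) κ l ((x - (N : ℤ) • q) + pshift (fine N M) t) := by
  rw [Hcol_apply, pshift_fine, smul_sub]
  congr 1
  abel

omit [∀ ν, NeZero (M ν)] in
/-- The shifted multiplier is the coarse-period translate of `wΦ`. -/
theorem HΦcol_sub_pshift (l : Fin (d + 1)) (q : Site (d + 1)) (t : Site (d + 1)) (κ : Fin (d + 1)) (y : Site (d + 1)) :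
    HΦcol (N := N) l (q - pshift M t) κ y = wΦ (N := N) κ l ((y - q) + pshift M t) := by
  rw [HΦcol_apply]
  congr 1
  abel

/-- Summability of the periodisation of the column. -/
theorem summable_Hcol_pshift (l : Fin (d + 1)) (q : Site (d + 1)) (κ : Fin (d + 1)) (x : Site (d + 1)) :
    Summable (fun t : Site (d + 1) => Hcol (N := N) l (q - pshift M t) κ x) := by
  obtain ⟨δ, C, hδ, h⟩ := decay_wH (N := N) (d := d)
  simp only [Hcol_sub_pshift]
  exact summable_pshift hδ (h κ l) (fine N M) _

/-- Summability of the periodisation of the multiplier. -/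
theorem summable_HΦcol_pshift (l : Fin (d + 1)) (q : Site (d + 1)) (κ : Fin (d + 1)) (y : Site (d + 1)) :
    Summable (fun t : Site (d + 1) => HΦcol (N := N) l (q - pshift M t) κ y) := by
  obtain ⟨δ, C, hδ, h⟩ := decay_wΦ (N := N) (d := d)
  simp only [HΦcol_sub_pshift]
  exact summable_pshift hδ (h κ l) M _

/-- `HasSum` form of the definition of `Hper`. -/
theorem hasSum_Hper (l : Fin (d + 1)) (q : Site (d + 1)) (κ : Fin (d + 1)) (x : Site (d + 1)) :
    HasSum (fun t : Site (d + 1) => Hcol (N := N) l (q - pshift M t) κ x) (Hper N M l q κ x) :=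
  (summable_Hcol_pshift N M l q κ x).hasSum

/-- `HasSum` form of the definition of `Φper`. -/
theorem hasSum_Φper (l : Fin (d + 1)) (q : Site (d + 1)) (κ : Fin (d + 1)) (y : Site (d + 1)) :
    HasSum (fun t : Site (d + 1) => HΦcol (N := N) l (q - pshift M t) κ y) (Φper N M l q κ y) :=
  (summable_HΦcol_pshift N M l q κ y).hasSum

/-- **(EL)^per — THE GAUGE-FREE EULER–LAGRANGE IDENTITY SURVIVES PERIODISATION**: `d*d ℋ^per = 𝒬ᵀ_N Φ^per` (an5's `curvAdj_curv_Hcol`, i.e.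
`wM_eq_zero`, term by term; the finite stencils commute with the absolutely convergent period sums). -/
theorem curvAdj_curv_Hper (l : Fin (d + 1)) (q : Site (d + 1)) :
    curvAdj (curv (Hper N M l q)) = contourSumAdj N (Φper N M l q) := by
  funext μ x
  have h1 : HasSum (fun t : Site (d + 1) => curvAdj (curv (Hcol (N := N) l (q - pshift M t))) μ x)
      (curvAdj (curv (Hper N M l q)) μ x) :=
    hasSum_curvAdj (fun κ l' y => hasSum_curv (fun κ' x' => hasSum_Hper N M l q κ' x') κ l' y) μ x
  have h2 : HasSum (fun t : Site (d + 1) => contourSumAdj N (HΦcol (N := N) l (q - pshift M t)) μ x)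
      (contourSumAdj N (Φper N M l q) μ x) :=
    hasSum_contourSumAdj (fun κ y => hasSum_Φper N M l q κ y) μ x
  have e : (fun t : Site (d + 1) => curvAdj (curv (Hcol (N := N) l (q - pshift M t))) μ x)
      = fun t => contourSumAdj N (HΦcol (N := N) l (q - pshift M t)) μ x := by
    funext t; rw [curvAdj_curv_Hcol]
  rw [e] at h1
  exact h1.unique h2

/-- **(Q)^per — THE BLOCK AVERAGES OF THE PERIODISED COLUMN**: `𝒬_N ℋ^per_{(l,q)} (κ, y) = [κ = l ∧ y ≡ q mod M]` (an5's `contourSum_Hcol`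
term by term: exactly one period translate of the source hits a congruent block). -/
theorem contourSum_Hper (l : Fin (d + 1)) (q : Site (d + 1)) (κ : Fin (d + 1)) (y : Site (d + 1)) :
    contourSum N (Hper N M l q) κ y = if κ = l ∧ toTor M y = toTor M q then 1 else 0 := by
  have h1 : HasSum (fun t : Site (d + 1) => contourSum N (Hcol (N := N) l (q - pshift M t)) κ y)
      (contourSum N (Hper N M l q) κ y) :=
    hasSum_contourSum (fun κ' x' => hasSum_Hper N M l q κ' x') κ y
  simp only [contourSum_Hcol] at h1
  by_cases h : κ = l ∧ toTor M y = toTor M q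
  · -- the unique translate: `q − y = pshift M t₀`
    have hd : ∀ ν, ((M ν : ℕ) : ℤ) ∣ q ν - y ν := by
      intro ν
      have hν := congr_fun h.2 ν
      simp only [toTor] at hν
      exact (ZMod.intCast_eq_intCast_iff_dvd_sub _ _ _).1 hν
    choose t₀ ht₀ using hd
    have hq : q - pshift M t₀ = y := by
      funext ν; simp only [Pi.sub_apply, pshift]; have := ht₀ ν; linarith
    have e : (fun t : Site (d + 1) => if y = q - pshift M t ∧ κ = l then (1 : ℝ) else 0) = fun t => if t = t₀ then 1 else 0 := by
      funext t
      by_cases ht : t = t₀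
      · subst ht; rw [if_pos ⟨hq.symm, h.1⟩, if_pos rfl]
      · rw [if_neg ht, if_neg]
        rintro ⟨hy, -⟩
        apply ht
        apply pshift_injective M
        have : q - pshift M t = q - pshift M t₀ := by rw [← hy, hq]
        simpa using this
    rw [e] at h1
    rw [if_pos h]
    exact h1.unique (hasSum_ite_eq t₀ 1)
  · rw [if_neg h]
    have e : (fun t : Site (d + 1) => if y = q - pshift M t ∧ κ = l then (1 : ℝ) else 0) = fun _ => 0 := by
      funext t
      rw [if_neg]
      rintro ⟨hy, hκ⟩
      apply h
      refine ⟨hκ, ?_⟩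
      rw [hy, toTor_sub, toTor_pshift, sub_zero]
    rw [e] at h1
    exact h1.unique hasSum_zero

omit [∀ ν, NeZero (M ν)] in
/-- The periodised column is periodic under the FINE period lattice `fine N M`. -/
theorem periodic_Hper (l : Fin (d + 1)) (q : Site (d + 1)) (κ : Fin (d + 1)) : Periodic (fine N M) (Hper N M l q κ) := by
  intro x ν
  simp only [Hper]
  have e : ∀ t : Site (d + 1), Hcol (N := N) l (q - pshift M t) κ (x + ((fine N M ν : ℕ) : ℤ) • AffineAveraging.unitVec ν)
      = Hcol (N := N) l (q - pshift M (t + AffineAveraging.unitVec ν)) κ x := by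
    intro t
    rw [Hcol_sub_pshift, Hcol_sub_pshift, pshift_add, pshift_unitVec]
    congr 1
    abel
  simp_rw [e]
  exact tsum_shift_index (fun t => Hcol (N := N) l (q - pshift M t) κ x) (AffineAveraging.unitVec ν)

omit [∀ ν, NeZero (M ν)] in
/-- The periodised multiplier is periodic under the COARSE period lattice `M`. -/
theorem periodic_Φper (l : Fin (d + 1)) (q : Site (d + 1)) (κ : Fin (d + 1)) : Periodic M (Φper N M l q κ) := by
  intro y ν
  simp only [Φper]
  have e : ∀ t : Site (d + 1), HΦcol (N := N) l (q - pshift M t) κ (y + ((M ν : ℕ) : ℤ) • AffineAveraging.unitVec ν)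
      = HΦcol (N := N) l (q - pshift M (t + AffineAveraging.unitVec ν)) κ y := by
    intro t
    rw [HΦcol_sub_pshift, HΦcol_sub_pshift, pshift_add, pshift_unitVec]
    congr 1
    abel
  simp_rw [e]
  exact tsum_shift_index (fun t => HΦcol (N := N) l (q - pshift M t) κ y) (AffineAveraging.unitVec ν)

omit [∀ ν, NeZero (M ν)] in
/-- The periodised multiplier at a congruent argument / source: it depends on `y − q` mod `M` only. -/
theorem Φper_congr (l : Fin (d + 1)) {q q' y y' : Site (d + 1)} (h : toTor M (y - q) = toTor M (y' - q')) (κ : Fin (d + 1)) :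
    Φper N M l q κ y = Φper N M l q' κ y' := by
  have hd : ∀ ν, ((M ν : ℕ) : ℤ) ∣ (y' ν - q' ν) - (y ν - q ν) := by
    intro ν
    have hν := congr_fun h ν
    simp only [toTor, Pi.sub_apply] at hν
    have := (ZMod.intCast_eq_intCast_iff_dvd_sub _ _ _).1 hν
    simpa using this
  choose t₀ ht₀ using hd
  have e : y' - q' = (y - q) + pshift M t₀ := by
    funext ν; simp only [Pi.sub_apply, Pi.add_apply, pshift]; have := ht₀ ν; linarith
  simp only [Φper, HΦcol_sub_pshift, e]
  have e2 : ∀ t : Site (d + 1), y - q + pshift M t₀ + pshift M t = (y - q) + pshift M (t + t₀) := by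
    intro t; rw [pshift_add]; abel
  simp_rw [e2]
  exact (tsum_shift_index (fun t => wΦ (N := N) κ l (y - q + pshift M t)) t₀).symm

end Columns

end Summit.QuantumFields.BalabanUV.Beta.GAN24.TorusPeriodise
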